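import Literature.Barriers.CriticalPhenomena.RigorousRGSmallParameterDiscreteBump
import Mathlib.Data.Nat.Choose.Sum
import HarnessLib

/-!
# `RigorousRGSmallParameter` (Slade, Theorem 1.4.1): the one-dimensional discrete Taylor (Newton)
# expansion with remainder — [BS-rg-loc] Lemma 3.3.3, core case

Companion ("proof architecture") file of
`Literature/Barriers/CriticalPhenomena/RigorousRGSmallParameter.lean` (Loc norm-estimates layer,
first brick towards [BS-rg-loc] Proposition 1.4.6 / (prop:LTKbound), the crucial `1 - Loc`
contraction). [BS-rg-loc] Lemma 3.3.3 (the Taylor remainder estimate behind Lemma (lem:phij)):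
"`|∇^β(g - Tay_a g)_z| ≤ M_g C(|z-a⃗|₁, s-t+1)`"; proof, case `p = 1`: "let `(Tφ)_x = φ_{x+1}` and
`D = T - I`. … `T^m = Σ_{α=0}^{s} C(m,α)D^α + E`, `E = Σ_{m≥n₁>n₂>⋯>n_{s+1}≥1} D^{s+1}T^{n_{s+1}-1}` …
`g_{z₁} = (T^{z₁}g)_0 = f_{z₁} + (Eg)_0`. The remainder term obeys the estimate
`|(Eg)_0| ≤ … = C(m,s+1) sup_{x∈S_0(z₁)}|D^{s+1}g_x|`." This file PROVES it on `ℤ` (functions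
`g : ℤ → ℝ`, `Δ = fwdDiff` of `…DiscreteBump`): the exact Newton formula, the remainder
`R_s(m)g = g(m) - Σ_{α≤s}C(m,α)(Δ^αg)(0)`, its recursion `R_{s+1}(m)g = Σ_{n<m}R_s(n)(Δg)` (hockey
stick), and **`|R_s(m)g| ≤ C(m,s+1)·sup_{0≤x≤m}|Δ^{s+1}g(x)|`**. All PROVED, 0 sorry:

* **`newton_forward`** (`g(x+m) = Σ_{α≤m}C(m,α)(Δ^αg)(x)`), `choose_succ_eq_sum` (hockey stick),
  `taylorRem`, `taylorRem_zero`, **`taylorRem_succ`**, **`abs_taylorRem_le`**.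

Sources: D. C. Brydges, G. Slade, *A renormalisation group method. II. Approximation by local
polynomials*, J. Stat. Phys. 159 (2015) 461–491, arXiv:1403.7253, Lemma 3.3.3 (statement
(e:Tayrem2), display (e:Tayrem) and the case `p = 1` of the proof), TeX-source numbering.

## References

* [BrydgesSlade2015RGII] D. C. Brydges, G. Slade, *A renormalisation group method. II.
  Approximation by local polynomials*, J. Stat. Phys. **159** (2015) 461–491, arXiv:1403.7253.
-/

noncomputable section

namespace Literature.Barriers.CriticalPhenomena

namespace LongRangePhi4

namespace Bump

open Finset

/-- **Newton's forward-difference formula** (exact): `g(x + m) = Σ_{α ≤ m} C(m,α) (Δ^α g)(x)`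
("`T^m = (I + D)^m`"). [cite: BrydgesSlade2015RGII, Lemma 3.3.3 (proof: T^m = Σ_α C(m,α)D^α + E)] -/
theorem newton_forward (g : ℤ → ℝ) : ∀ (m : ℕ) (x : ℤ),
    g (x + m) = ∑ α ∈ range (m + 1), (m.choose α : ℝ) * (fwdDiff^[α] g) x
  | 0, x => by simp
  | m + 1, x => by
      -- `g(x+m+1) = g((x+1)+m)` expanded at `x+1`, and `(Δ^α g)(x+1) = (Δ^α g)(x) + (Δ^{α+1} g)(x)`
      have ih := newton_forward g m (x + 1)
      have hstep : ∀ α, (fwdDiff^[α] g) (x + 1) = (fwdDiff^[α] g) x + (fwdDiff^[α + 1] g) x := by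
        intro α
        rw [Function.iterate_succ_apply']
        simp [fwdDiff]
      rw [show x + ((m + 1 : ℕ) : ℤ) = (x + 1) + (m : ℤ) by push_cast; ring, ih]
      simp only [hstep, mul_add, Finset.sum_add_distrib]
      -- reindex the second sum and use Pascal
      rw [Finset.sum_range_succ' (fun α => ((m + 1).choose α : ℝ) * (fwdDiff^[α] g) x)]
      simp only [Nat.choose_zero_right, Nat.cast_one, one_mul, Function.iterate_zero, id_eq, Nat.choose_succ_succ', Nat.cast_add,
        add_mul, Finset.sum_add_distrib]
      have h0 : ∑ α ∈ range (m + 1), (m.choose (α + 1) : ℝ) * (fwdDiff^[α + 1] g) x =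
          ∑ α ∈ range (m + 1), (m.choose α : ℝ) * (fwdDiff^[α] g) x - g x := by
        rw [Finset.sum_range_succ' (fun α => (m.choose α : ℝ) * (fwdDiff^[α] g) x), Finset.sum_range_succ]
        simp [Nat.choose_succ_self]
      rw [h0]
      have h1 : ∑ α ∈ range (m + 1), (m.choose α : ℝ) * (fwdDiff^[α] g) x =
          g x + ∑ α ∈ range m, (m.choose (α + 1) : ℝ) * (fwdDiff^[α + 1] g) x := by
        rw [Finset.sum_range_succ' (fun α => (m.choose α : ℝ) * (fwdDiff^[α] g) x)]
        simp [add_comm]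
      linarith [h1]

/-- `C(m, s+1) = Σ_{n<m} C(n, s)` (hockey stick). [folklore] -/
theorem choose_succ_eq_sum (m s : ℕ) : (m.choose (s + 1) : ℝ) = ∑ n ∈ range m, (n.choose s : ℝ) := by
  induction m with
  | zero => simp
  | succ m ih => rw [Finset.sum_range_succ, ← ih, Nat.choose_succ_succ', Nat.cast_add, add_comm]

/-- The Taylor remainder `R_s(m) g = g(m) - Σ_{α ≤ s} C(m,α)(Δ^α g)(0)`. [cite: BrydgesSlade2015RGII, Lemma 3.3.3 ((e:Tayrem))] -/
def taylorRem (s : ℕ) (m : ℕ) (g : ℤ → ℝ) : ℝ := g m - ∑ α ∈ range (s + 1), (m.choose α : ℝ) * (fwdDiff^[α] g) 0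

/-- The remainder with no Taylor terms is the increment: `R_0(m)g = g(m) - g(0)`. [folklore] -/
theorem taylorRem_zero (m : ℕ) (g : ℤ → ℝ) : taylorRem 0 m g = g m - g 0 := by
  simp [taylorRem]

/-- **The recursion** `R_{s+1}(m) g = Σ_{n<m} R_s(n)(Δg)` (hockey stick `C(m,α+1) = Σ_{n<m} C(n,α)`
and `g(m) - g(0) = Σ_{n<m} Δg(n)`). [folklore] -/
theorem taylorRem_succ (s m : ℕ) (g : ℤ → ℝ) : taylorRem (s + 1) m g = ∑ n ∈ range m, taylorRem s n (fwdDiff g) := by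
  unfold taylorRem
  -- telescoping for `g m - g 0`
  have htel : g m - g 0 = ∑ n ∈ range m, fwdDiff g n := by
    induction m with
    | zero => simp
    | succ m ih =>
        rw [Finset.sum_range_succ, ← ih]
        simp [fwdDiff]
  -- hockey stick inside the Taylor sum
  have hsum : ∑ α ∈ range (s + 1 + 1), (m.choose α : ℝ) * (fwdDiff^[α] g) 0 =
      g 0 + ∑ α ∈ range (s + 1), (∑ n ∈ range m, (n.choose α : ℝ)) * (fwdDiff^[α] (fwdDiff g)) 0 := by
    rw [Finset.sum_range_succ' (fun α => (m.choose α : ℝ) * (fwdDiff^[α] g) 0)]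
    simp only [Nat.choose_zero_right, Nat.cast_one, one_mul, Function.iterate_zero, id_eq]
    rw [add_comm]
    congr 1
    refine Finset.sum_congr rfl fun α _ => ?_
    rw [Function.iterate_succ_apply, choose_succ_eq_sum]
  rw [hsum]
  have hg : g m = g 0 + ∑ n ∈ range m, fwdDiff g n := by linarith
  rw [hg]
  simp only [Finset.sum_mul]
  rw [Finset.sum_comm, Finset.sum_sub_distrib]
  ring

/-- **[BS-rg-loc] Lemma 3.3.3, one-dimensional core**: `|R_s(m) g| ≤ C(m, s+1) sup_{0 ≤ x ≤ m} |Δ^{s+1} g(x)|`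
("The remainder term obeys the estimate `|(Eg)_0| ≤ Σ_{m≥n₁>⋯>n_{s+1}≥1} sup|D^{s+1}g_x| = C(m,s+1) sup|D^{s+1}g_x|`").
[cite: BrydgesSlade2015RGII, Lemma 3.3.3 (display (e:Tayrem) and the case p = 1 of the proof)] -/
theorem abs_taylorRem_le : ∀ (s m : ℕ) (g : ℤ → ℝ) (C : ℝ), (∀ x : ℤ, 0 ≤ x → x ≤ m → |(fwdDiff^[s + 1] g) x| ≤ C) →
    |taylorRem s m g| ≤ (m.choose (s + 1) : ℝ) * C
  | 0, m, g, C, hC => by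
      rw [taylorRem_zero, zero_add, Nat.choose_one_right]
      have htel : g m - g 0 = ∑ n ∈ range m, fwdDiff g n := by
        clear hC
        induction m with
        | zero => simp
        | succ m ih =>
            rw [Finset.sum_range_succ, ← ih]
            simp [fwdDiff]
      rw [htel]
      calc |∑ n ∈ range m, fwdDiff g n| ≤ ∑ n ∈ range m, C := by
            refine (Finset.abs_sum_le_sum_abs _ _).trans (Finset.sum_le_sum fun n hn => ?_)
            rw [Finset.mem_range] at hn
            have := hC n (by positivity) (by exact_mod_cast hn.le)
            simpa using this
        _ = (m : ℝ) * C := by rw [Finset.sum_const, Finset.card_range, nsmul_eq_mul]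
  | s + 1, m, g, C, hC => by
      rw [taylorRem_succ]
      calc |∑ n ∈ range m, taylorRem s n (fwdDiff g)| ≤ ∑ n ∈ range m, (n.choose (s + 1) : ℝ) * C := by
            refine (Finset.abs_sum_le_sum_abs _ _).trans (Finset.sum_le_sum fun n hn => ?_)
            rw [Finset.mem_range] at hn
            refine abs_taylorRem_le s n (fwdDiff g) C fun x h0 hx => ?_
            rw [← Function.iterate_succ_apply fwdDiff (s + 1) g]
            have hnm : (n : ℤ) ≤ m := by exact_mod_cast hn.le
            exact hC x h0 (by linarith)
        _ = (m.choose (s + 1 + 1) : ℝ) * C := by rw [← Finset.sum_mul, ← choose_succ_eq_sum]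

end Bump

end LongRangePhi4

end Literature.Barriers.CriticalPhenomena
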